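import Mathlib.Algebra.MvPolynomial.Degrees
import Mathlib.Data.Finsupp.Weight
import Literature.Computability.AlgebraicComplexity.ArithCircuitProofs
import Literature.RingTheory.Nullstellensatz.PerronTheorem
import HarnessLib

/-!
# Sparse polynomials have small circuits; restrictions to few variables are sparse

Topic `Computability/AlgebraicComplexity`. Elementary size bounds in the tree's circuit model
(`complexity` = fan-in-two circuit size, constants and inputs free, `ArithCircuit.lean`) that the
hardness-versus-randomness arguments of Kabanets–Impagliazzo (STOC 2003, proof of Lemma 30:
"each restriction is a polynomial of degree at most `d_p` on at most `log n` variables … Every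
such polynomial contains at most `M = (d_p + 1)^{log n}` distinct monomials, and so can be
computed by an arithmetic circuit of size `poly(M)`") and Kumar–Ramya–Saptharishi–Tengse (STACS
2022, Lemma 8: the factor `(d+1)^n`) use for the substituted copies of the hard polynomial:

* `complexity_monomial_le` — `L(c · x^m) ≤ 2|m| + 1`;
* `complexity_le_card_support_mul` — `L(p) ≤ #supp(p) · (2 deg p + 2)`;
* `card_support_le_pow` — a polynomial in `#σ` variables has `≤ (deg p + 1)^{#σ}` monomials;
  `complexity_le_pow_card` — hence `L(p) ≤ (deg p + 1)^{#σ} (2 deg p + 2)`;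
* `complexity_aeval_restrict_le` — substituting constants for all variables of `f` outside a set
  `T` of `≤ r` positions (and renaming those in `T`) gives a polynomial of size
  `≤ (deg f + 1)^r (2 deg f + 2)`.

All statements over an arbitrary commutative semiring. (Total degree is used throughout; the
sharper individual-degree count `(δ+1)^r` of KRST is not formalised.)

## References

* [KabanetsImpagliazzo2003] V. Kabanets, R. Impagliazzo, *Derandomizing polynomial identity
  tests means proving circuit lower bounds*, STOC 2003, Lemma 30 (proof, part II).
* [Burgisser2000] P. Bürgisser, *Completeness and Reduction in Algebraic Complexity Theory*,
  Springer 2000, §2.1 (the cost of sums and products).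
-/

noncomputable section

namespace Literature.Computability.AlgebraicComplexity

open MvPolynomial Finset

variable {F : Type*} [CommSemiring F] {σ β : Type*}

/-- `|m| = Σ_i m_i` in Mathlib's two spellings. [folklore] -/
private theorem degree_eq_sum' (m : σ →₀ ℕ) : m.degree = m.sum (fun _ e => e) := by
  rw [Finsupp.degree_apply]; rfl

/-- A monomial of `p` has weight at most `deg p`. [folklore] -/
private theorem degree_le_totalDegree {p : MvPolynomial σ F} {m : σ →₀ ℕ} (hm : m ∈ p.support) :
    m.degree ≤ p.totalDegree := by
  rw [degree_eq_sum']; exact le_totalDegree hm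

/-- `deg x_s ≤ 1` (no `Nontrivial` hypothesis). [folklore] -/
private theorem totalDegree_X_le' (s : σ) : (X s : MvPolynomial σ F).totalDegree ≤ 1 := by
  show (monomial (Finsupp.single s 1) (1 : F)).totalDegree ≤ 1
  refine (totalDegree_monomial_le (Finsupp.single s 1) (1 : F)).trans (le_of_eq ?_)
  exact Finsupp.sum_single_index rfl

/-- `L(x^j) ≤ j`. [folklore] -/
private theorem complexity_X_pow_le (v : σ) (j : ℕ) :
    complexity (X v ^ j : MvPolynomial σ F) ≤ j := by
  rw [Finset.pow_eq_prod_const]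
  refine (complexity_finset_prod_le _ _).trans ?_
  rw [Finset.sum_eq_zero fun _ _ => complexity_X_holds (k := F) (σ := σ) v, Finset.card_range,
    zero_add]

/-- A monomial `c · x^m` has circuit complexity `≤ 2 |m| + 1` (the powers, their product, one
scalar gate; constants and inputs are free).
[cite: KabanetsImpagliazzo2003, Lemma 30 (proof, II: "computed by an arithmetic circuit of size poly(M)")] -/
theorem complexity_monomial_le (m : σ →₀ ℕ) (c : F) :
    complexity (monomial m c : MvPolynomial σ F) ≤ 2 * m.degree + 1 := by
  have hdeg : ∑ i ∈ m.support, m i = m.degree := (Finsupp.degree_apply m).symm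
  have hcard : m.support.card ≤ m.degree := by
    calc m.support.card = ∑ i ∈ m.support, 1 := by simp
      _ ≤ ∑ i ∈ m.support, m i := Finset.sum_le_sum fun i hi =>
          Nat.one_le_iff_ne_zero.2 (Finsupp.mem_support_iff.1 hi)
      _ = m.degree := hdeg
  have hprod : (m.prod fun n e => (X n : MvPolynomial σ F) ^ e) =
      ∏ i ∈ m.support, (X i : MvPolynomial σ F) ^ m i := rfl
  rw [monomial_eq, hprod]
  calc complexity (C c * ∏ i ∈ m.support, (X i : MvPolynomial σ F) ^ m i)
      ≤ complexity (C c : MvPolynomial σ F) +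
          complexity (∏ i ∈ m.support, (X i : MvPolynomial σ F) ^ m i) + 1 :=
        complexity_mul_le_holds _ _
    _ ≤ 0 + (∑ i ∈ m.support, complexity ((X i : MvPolynomial σ F) ^ m i) + m.support.card) + 1 := by
        gcongr
        · exact (complexity_C_holds (σ := σ) c).le
        · exact complexity_finset_prod_le _ _
    _ ≤ 0 + (∑ i ∈ m.support, m i + m.degree) + 1 := by
        gcongr with i hi
        exact complexity_X_pow_le i (m i)
    _ = 2 * m.degree + 1 := by rw [hdeg]; ring

/-- **Sparse polynomials have small circuits**: `L(p) ≤ #supp(p) · (2 deg p + 2)` (sum of the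
monomials). [cite: KabanetsImpagliazzo2003, Lemma 30 (proof, II)] -/
theorem complexity_le_card_support_mul (p : MvPolynomial σ F) :
    complexity p ≤ p.support.card * (2 * p.totalDegree + 2) := by
  classical
  conv_lhs => rw [p.as_sum]
  refine (complexity_finset_sum_le _ _).trans ?_
  calc ∑ m ∈ p.support, complexity (monomial m (coeff m p)) + p.support.card
      ≤ ∑ m ∈ p.support, (2 * p.totalDegree + 1) + p.support.card := by
        gcongr with m hm
        exact (complexity_monomial_le m _).trans (by have := degree_le_totalDegree hm; omega)
    _ = p.support.card * (2 * p.totalDegree + 2) := by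
        rw [Finset.sum_const, smul_eq_mul]; ring

/-- **Few monomials in few variables**: a polynomial in `#σ` variables has at most
`(deg p + 1)^{#σ}` monomials (every exponent is `≤ deg p`).
[cite: KabanetsImpagliazzo2003, Lemma 30 (proof, II: "at most M = (d_p+1)^{log n} distinct monomials")] -/
theorem card_support_le_pow [Fintype σ] (p : MvPolynomial σ F) :
    p.support.card ≤ (p.totalDegree + 1) ^ Fintype.card σ := by
  classical
  have key : ∀ m ∈ p.support, ∀ i, m i < p.totalDegree + 1 := fun m hm i =>
    Nat.lt_succ_of_le ((Finsupp.le_degree i m).trans (degree_le_totalDegree hm))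
  let φ : p.support → (σ → Fin (p.totalDegree + 1)) := fun m i => ⟨m.1 i, key m.1 m.2 i⟩
  have hφ : Function.Injective φ := by
    intro m m' h
    apply Subtype.ext
    ext i
    have := congrFun h i
    simpa [φ] using this
  calc p.support.card = Fintype.card p.support := (Fintype.card_coe _).symm
    _ ≤ Fintype.card (σ → Fin (p.totalDegree + 1)) := Fintype.card_le_of_injective φ hφ
    _ = (p.totalDegree + 1) ^ Fintype.card σ := by simp

/-- Combining: `L(p) ≤ (deg p + 1)^{#σ} · (2 deg p + 2)` for a polynomial in `#σ` variables.
[cite: KabanetsImpagliazzo2003, Lemma 30 (proof, II)] -/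
theorem complexity_le_pow_card [Fintype σ] (p : MvPolynomial σ F) :
    complexity p ≤ (p.totalDegree + 1) ^ Fintype.card σ * (2 * p.totalDegree + 2) :=
  (complexity_le_card_support_mul p).trans (Nat.mul_le_mul_right _ (card_support_le_pow p))

/-- **Restriction lemma** (KI: "each restriction is a polynomial of degree at most `d_p` on at
most `log n` variables"): substituting constants `c_b` for the variables of `f` outside a set
`T` of at most `r` positions, and variables `x_{π b}` for `b ∈ T`, yields a polynomial of circuit
complexity `≤ (deg f + 1)^r · (2 deg f + 2)`. [cite: KabanetsImpagliazzo2003, Lemma 30 (proof, II)] -/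
theorem complexity_aeval_restrict_le [DecidableEq β] {τ : Type*}
    (f : MvPolynomial β F) (g : β → MvPolynomial τ F) (T : Finset β) (π : β → τ) (c : β → F)
    (hT : ∀ b ∈ T, g b = X (π b)) (hT' : ∀ b ∉ T, g b = C (c b)) {r : ℕ} (hr : T.card ≤ r) :
    complexity (aeval g f) ≤ (f.totalDegree + 1) ^ r * (2 * f.totalDegree + 2) := by
  -- factor the substitution through the polynomial ring on the variables `T`
  set h : β → MvPolynomial T F := fun b => if hb : b ∈ T then X ⟨b, hb⟩ else C (c b) with hh
  set q : MvPolynomial T F := aeval h f with hq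
  have hfac : aeval g f = rename (fun t : T => π t) q := by
    rw [hq, ← AlgHom.comp_apply, comp_aeval]
    refine congrArg (fun g' => aeval g' f) (funext fun b => ?_)
    by_cases hb : b ∈ T
    · rw [hT b hb, hh]
      simp only [hb, dif_pos, rename_X]
    · rw [hT' b hb, hh]
      simp only [hb, dif_neg, not_false_eq_true, rename_C]
  have hdeg : q.totalDegree ≤ f.totalDegree := by
    have h1 : ∀ b, (h b).totalDegree ≤ 1 := by
      intro b
      by_cases hb : b ∈ T
      · rw [hh]; simp only [hb, dif_pos]; exact totalDegree_X_le' _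
      · rw [hh]; simp only [hb, dif_neg, not_false_eq_true, totalDegree_C]; exact Nat.zero_le _
    exact (Literature.RingTheory.Nullstellensatz.totalDegree_aeval_le h h1 f).trans
      (by rw [mul_one])
  have hcardT : Fintype.card T ≤ r := by rwa [Fintype.card_coe]
  calc complexity (aeval g f) = complexity (rename (fun t : T => π t) q) := by rw [hfac]
    _ ≤ complexity q := complexity_rename_le_holds' _ _
    _ ≤ (q.totalDegree + 1) ^ Fintype.card T * (2 * q.totalDegree + 2) := complexity_le_pow_card q
    _ ≤ (f.totalDegree + 1) ^ Fintype.card T * (2 * f.totalDegree + 2) := by gcongr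
    _ ≤ (f.totalDegree + 1) ^ r * (2 * f.totalDegree + 2) :=
        Nat.mul_le_mul_right _ (Nat.pow_le_pow_right (Nat.succ_pos _) hcardT)

end Literature.Computability.AlgebraicComplexity

end
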